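import Summits.QuantumFields.BalabanUV.T4Continuum.Support.NE7DbarResidualLetters
import Summits.QuantumFields.BalabanUV.T4Continuum.Support.NE7DecompOfTopNormalised
import HarnessLib

/-!
# Support | NE7 (gen 98, ROAD-Γ′ S5′ — THE `hdecomp♭` DECOMPOSITION AND ITS TWO LETTERS UNDER `hdbar` ALONE, MODULO THE THREE MASSES AND THE TWO FRAME MASSES): the S2′ twin of
# `NE7DecompOfTopNormalised.decomp_of_topNormalised` — at a unitary `W` in the tower class with a trivial top DOUBLE-BAR field of the perturbation (`dbavgCovIter L W (relPert W X) (j+1) = 1`;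
# NO corner-trivial gauge, NO trivial accumulated frame), `X = X_T + X_N`, `X_T ∈ T_♮(W)`, with `‖X_N‖_w ≤ (ν_S′ + ν_R + ν_μ)‖X‖_w` and `x·Σ‖curl_W X_N‖ ≤ (κ_S′ + κ_R + κ_μ)‖X‖_w²`

Cell `pub-balaban`, rung (B)+1 sub-cell t4, lineage `b2b-balaban-t4-ne7-p1` (CRUX PROVER NE7 #1 = OWNER of row NE7), generation 98; memo `t4/b2b-balaban-t4-ne7-p1-g98/ROAD-G98.md` §2.8.
Pure composition BY NAME of S4a′ `NE7DbarResidualLetters.tangentResidual_letters_of_dbar`, leaf-02's `NE3FrameFreeDecompositionW.exists_cornerGauge_mem_frameFreeBlockLandauW`, this gen's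
`NE7PureGaugePieceLetters`, and the seminorm bookkeeping — exactly as in p743702, with the pair data replaced by `hdbar` and the frame masses `Θ₂, Θ₁`.

WHY (memo §2.8).  Under the repaired top normalisation S2′ the representative satisfies `hdbar` with a NON-corner-trivial gauge; THIS FILE is S5 in that currency.
WHAT ([folklore]; 0 def, 0 sorry).  **`decomp_of_dbar`**.
HONEST FRAMING (page 1): composition and real arithmetic over landed kernel theorems; nothing of Bałaban's asserted; S2′, the masses, `hdecomp♭` and NE7 are NOT proved; spine 0∕9; finite T⁴ rung (B)+1
— NOT infinite volume, NOT mass gap, NOT `BetaPertH`, NOT Clay.  Continuum YM on T⁴ ⇐ BetaPertH ∧ nine spine estimates (0/9 proved); BetaPertH ⇐ (D1) ∧ (D4) ∧ CAP+tail; G-an2-4 gates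
asym, D1 and NE2/3/4.
-/

set_option autoImplicit false

open scoped BigOperators Matrix Matrix.Norms.L2Operator
open NormedSpace Finset

namespace Summit.QuantumFields.BalabanUV.T4Continuum.NE7DecompOfDbar

open Literature.MathematicalPhysics.QuantumFieldTheory.Balaban1983to89
open B7Prop1Explicit B7Prop2Explicit B7Prop3Flat MatrixLog
open T4AveragingDeficitWall (Ad IsUnitaryCfg IsSkewDir SmallField vary curl dirL1 dirSq curlSq)
open T4AveragingDeficitWallBoundary (IsPeriodicCfg periodBox)
open AveragingDeficitPeriodicCounting (IsPeriodicDir)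
open AveragingDeficitMultiLevelPrep (cavgIter LevelSmall tower TangentIter)
open B7Eq92Concrete (vcov)
open NE3TangentCovariantTower (dirIter QbarIter framePotW tangentIter_iff_dirIter_eq_zero)
open NE3.PairLandauB8Avg (relPert)
open ReplicationRightInverseBound (radSum)
open BlockAverageVaryHolo (nbRad)
open NE3CovariantLineSumsError (Csup)
open ShellMeasureAverageProp4General (C1cov C1cov_pos)
open BlockAveragePushDirGauge (gaugeDir isPeriodicDir_gaugeDir)
open NE3CornerSpikes (spikeW)
open NE3QbarIterCovLiftPrep (cruxC)
open NE3SmoothRightInverseW (rightInvW)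
open NE3RightInverseSolveLetters (thetaLoc)
open NE3RightInverseL2Letter (l2C l2C_nonneg)
open NE3HatInvCurlLetters (curl2C curl1C curl2C_nonneg curl1C_nonneg)
open NE3EnergyWeightedShapes (energyNormW energyNormW_nonneg)
open NE3ProductPathBounds (energyNormW_sub_le curl_sub_dir)
open NE3EnergyHessContTwoTerm (curlSq_nonneg dirSq_nonneg)
open NE3SmoothLiftW (tower_eq_pow_mul)
open NE3LandauOrbit (gaugeDir_skew)
open NE3FrameFreeSliceW (frameFreeBlockLandauW)
open NE3FrameFreeDecompositionW (exists_cornerGauge_mem_frameFreeBlockLandauW)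
open NE3CurlOfGaugeDir (curlSq_gaugeDir_le)
open MinimalActionLevels (perWin)
open NE7TopNormalisedSpikeEnergyLetters (energyNormW_le_of_sq_le sq_mul_le_sq_of_one_le)
open B7Eq92Concrete (dbavgCovIter)
open NE7DbarResidualLetters (tangentResidual_letters_of_dbar)
open NE7DecompOfTopNormalised (energyNormW_gaugeDir_le_of_masses curlL1_gaugeDir_le_of_mass)

noncomputable section

variable {d : ℕ} {n : Type*} [Fintype n] [DecidableEq n]

/-! ## §1 The decomposition under `hdbar`, modulo the masses -/

/-- **ROAD-Γ′ S5-CONDITIONAL — THE `hdecomp♭` SPLIT AND ITS TWO LETTERS FROM A TOP-NORMALISED REPRESENTATIVE, MODULO THE THREE MASSES OF THE SLICE-CORRECTING GENERATOR.**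
Setting of S4a (`NE7TopNormalisedResidualLetters.tangentResidual_letters_of_frameTrivial`: NE7's pair `U_A^{u} = W·e^{X}` with `u` corner-trivial, common `(j+1)`-fold average, tower class at
`W` of period `N·M`, row NE3's W6 regime, the Prop-4∕(Γ1) regime in `α₀, b`, the ℓ¹ tower line, `44dL·Mb ≤ 1`, TRIVIAL TOP FRAME `v_{j+1} ≡ 1`, ceilings `Γ₁…Γ₄`) plus `2 ≤ L^d` and
the MASS HYPOTHESIS `hμ`: every skew periodic corner-trivial `μ` that puts the tangent residual `X − X_N⁰` into `T_♮(W)` has `dirSq (gaugeDir W μ) ≤ m₂M²‖X‖_w²`, `Σ‖μ‖² ≤ p₂M⁴‖X‖_w²`,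
`Σ‖μ‖ ≤ m₁M³‖X‖_w²` over the period box.  CONCLUSION: `X = X_T + X_N`, `X_T ∈ frameFreeBlockLandauW L N (j+1) W`, `X_N` skew, `‖X_N‖_w ≤ ν‖X‖_w`, `x·Σ_{perWin(N·M)}‖curl_W X_N‖ ≤ κ‖X‖_w²`
with `ν = ν_S + ν_R + √(4(M²x)²·#Plane·p₂ + m₂)` and `κ = κ_S + κ_R + 2·#Plane·(M²x)²·m₁` (`ν_S, ν_R, κ_S, κ_R` of S4a). [folklore] -/
theorem decomp_of_dbar [Nonempty n] {L N : ℕ} [NeZero N] (hL : 2 ≤ L) (hLd : 2 ≤ L ^ d) (hN : 1 ≤ N) (j : ℕ)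
    {W : Site d → Fin d → (Matrix n n ℂ)ˣ} {x : ℝ} (hWu : IsUnitaryCfg W) (hWP : IsPeriodicCfg W ((N * L ^ (j + 1) : ℕ) : ℤ))
    (hx : 0 ≤ x) (hsm : LevelSmall d L j x) (hWx : SmallField W x)
    (hθ : cruxC d L * (((L : ℝ) ^ (j + 1)) ^ 2 * x) < 1) (hθl : thetaLoc d L * (((L : ℝ) ^ (j + 1)) ^ 2 * x) < 1) (hε : ((L : ℝ) ^ (j + 1)) ^ 2 * x ≤ 1)
    {α₀ b : ℝ} (hα : 0 < α₀) (hα3 : C0 d * (2 * α₀) ≤ 1 / 3) (hα4 : 4 * (2 * α₀) ≤ c2' d L)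
    (h52 : pdev W < α₀ * (((L : ℝ) ^ (j + 1))⁻¹) ^ 2) (hb : 0 ≤ b)
    {X : Site d → Fin d → Matrix n n ℂ} (hX : ∀ (y : Site d) (κ : Fin d), ‖X y κ‖ ≤ b) (hXP : IsPeriodicDir X ((N * L ^ (j + 1) : ℕ) : ℤ)) (hXs : IsSkewDir X)
    (hsmall : Real.exp (4 * (800 * ((d : ℝ) + 1) ^ 2 * ((d : ℝ) + 4)) * α₀)
      * (1 + 8 * (131072 * ((d : ℝ) + 1) ^ 2) * ((L : ℝ) ^ (j + 1) * b)) ≤ 2)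
    (hc₃ : 4 * ((L : ℝ) ^ (j + 1) * b) ≤ c3 d L)
    (hK : 16 * (C1cov d * (L : ℝ) ^ 2 * Real.sqrt (d * (2 * (2 * L) + 1) ^ d)) * (L : ℝ) ^ (j + 1) * b ≤ Real.sqrt ((L : ℝ) ^ 2 / (L : ℝ) ^ d))
    (hS1 : (16 * (d + 1) * (d + 4) * (L : ℝ) ^ 2 * Csup d L * (d * (2 * nbRad d L + 1) ^ d)) * radSum d L j x ≤ ((L : ℝ) / (L : ℝ) ^ d) / 2)
    (h44 : 44 * ((d : ℝ) * L * ((L : ℝ) ^ (j + 1) * b)) ≤ 1)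
    (hdbar : dbavgCovIter L W (relPert W X) (j + 1) = 1)
    {Θ₂ Θ₁ : ℝ} (hΘ₂0 : 0 ≤ Θ₂) (hΘ₂ : ∑ z ∈ periodBox (d := d) N, ‖mlog ((vcov L W (relPert W X) (j + 1) z : (Matrix n n ℂ)ˣ) : Matrix n n ℂ)‖ ^ 2
      ≤ Θ₂ * ((L : ℝ) ^ (j + 1)) ^ 2 * energyNormW L (j + 1) W X (periodBox (d := d) (N * L ^ (j + 1))) ^ 2)
    (hΘ₁0 : 0 ≤ Θ₁) (hΘ₁ : ∑ z ∈ periodBox (d := d) N, ‖mlog ((vcov L W (relPert W X) (j + 1) z : (Matrix n n ℂ)ˣ) : Matrix n n ℂ)‖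
      ≤ Θ₁ * ((L : ℝ) ^ (j + 1)) ^ 2 * energyNormW L (j + 1) W X (periodBox (d := d) (N * L ^ (j + 1))) ^ 2)
    {Γ₁ Γ₂ Γ₃ Γ₄ : ℝ} (hΓ₁ : ∑ m ∈ range (j + 1), (L : ℝ) ^ m * ((L : ℝ) ^ 2 / (L : ℝ) ^ d) ^ m ≤ Γ₁)
    (hΓ₂ : ((j : ℝ) + 1) * ∑ i ∈ range j, ((L : ℝ) ^ 2 * ((L : ℝ) ^ 2 / (L : ℝ) ^ d)) ^ i ≤ Γ₂ * ((L : ℝ) ^ (j + 1)) ^ 2)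
    (hΓ₃ : ∑ i ∈ range j, (((L : ℝ) / (L : ℝ) ^ d) * L) ^ i ≤ Γ₃) (hΓ₄ : ∑ m ∈ range (j + 1), ((L : ℝ) ^ 2 / (L : ℝ) ^ d) ^ m ≤ Γ₄)
    {m₂ p₂ m₁ : ℝ} (hm₂ : 0 ≤ m₂) (hp₂ : 0 ≤ p₂) (hm₁ : 0 ≤ m₁)
    (hμ : ∀ (hYs : IsSkewDir (dirIter L (j + 1) W (fun y ν => X y ν - gaugeDir W (spikeW (L ^ (j + 1)) (framePotW L (j + 1) W X)) y ν)))
        (mu : Site d → Matrix n n ℂ), (∀ y, mu y ∈ skewAdjoint (Matrix n n ℂ)) →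
        (∀ (y : Site d) (i : Fin d), mu (y + ((N * L ^ (j + 1) : ℕ) : ℤ) • e i) = mu y) → (∀ w : Site d, mu (((L : ℤ) ^ (j + 1)) • w) = 0) →
        (fun y ν => (X y ν - (gaugeDir W (spikeW (L ^ (j + 1)) (framePotW L (j + 1) W X)) + rightInvW hL j hWu hx hsm hWx N hθ hYs) y ν) + gaugeDir W mu y ν)
          ∈ frameFreeBlockLandauW (d := d) (n := n) L N (j + 1) W →
        dirSq (gaugeDir W mu) (periodBox (d := d) (N * L ^ (j + 1))) ≤ m₂ * ((L : ℝ) ^ (j + 1)) ^ 2 * energyNormW L (j + 1) W X (periodBox (d := d) (N * L ^ (j + 1))) ^ 2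
        ∧ ∑ z ∈ periodBox (d := d) (N * L ^ (j + 1)), ‖mu z‖ ^ 2 ≤ p₂ * ((L : ℝ) ^ (j + 1)) ^ 4 * energyNormW L (j + 1) W X (periodBox (d := d) (N * L ^ (j + 1))) ^ 2
        ∧ ∑ z ∈ periodBox (d := d) (N * L ^ (j + 1)), ‖mu z‖ ≤ m₁ * ((L : ℝ) ^ (j + 1)) ^ 3 * energyNormW L (j + 1) W X (periodBox (d := d) (N * L ^ (j + 1))) ^ 2) :
    ∃ (XT XN : Site d → Fin d → Matrix n n ℂ) (ν κ : ℝ),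
      X = XT + XN ∧ XT ∈ frameFreeBlockLandauW (d := d) (n := n) L N (j + 1) W ∧ IsSkewDir XN ∧ 0 ≤ ν ∧
      energyNormW L (j + 1) W XN (periodBox (d := d) (N * L ^ (j + 1))) ≤ ν * energyNormW L (j + 1) W X (periodBox (d := d) (N * L ^ (j + 1))) ∧
      x * ∑ p ∈ perWin d (N * L ^ (j + 1)), ‖curl W XN p‖ ≤ κ * energyNormW L (j + 1) W X (periodBox (d := d) (N * L ^ (j + 1))) ^ 2 ∧
      ν = (2 * Real.sqrt (((Fintype.card (T4AveragingDeficitWall.Plane d) : ℝ) + d)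
                * (3 * Θ₂ + (12288 * ((d : ℝ) ^ 3 * (L : ℝ) ^ 5) * Γ₁ + 3072 * ((d : ℝ) * L) * (C1cov d * (L : ℝ) ^ 2 * Real.sqrt (d * (2 * (2 * L) + 1) ^ d)) ^ 2 * Γ₂)
                  * ((L : ℝ) ^ (j + 1) * b) ^ 2))
              + Real.sqrt ((l2C d L / (1 - thetaLoc d L * (((L : ℝ) ^ (j + 1)) ^ 2 * x)) ^ 2 + curl2C d L / (1 - thetaLoc d L * (((L : ℝ) ^ (j + 1)) ^ 2 * x)) ^ 2)
                  * (1024 * (C1cov d * (L : ℝ) ^ 2 * Real.sqrt (d * (2 * (2 * L) + 1) ^ d)) ^ 2 * ((L : ℝ) ^ d / (L : ℝ) ^ 4)))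
                * ((L : ℝ) ^ (j + 1) * b))
            + Real.sqrt (4 * (((L : ℝ) ^ (j + 1)) ^ 2 * x) ^ 2 * (Fintype.card (T4AveragingDeficitWall.Plane d)) * p₂ + m₂) ∧
      κ = (2 * (Fintype.card (T4AveragingDeficitWall.Plane d) : ℝ)
                * (Θ₁ + (16 * ((d : ℝ) * L) * (6 * Γ₁ + 2 * Γ₄) + 64 * (C1cov d * (L : ℝ) ^ 2 * (d * (2 * (2 * (L : ℝ)) + 1) ^ d)) * Γ₃))
                * (((L : ℝ) ^ (j + 1)) ^ 2 * x) ^ 2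
              + (curl1C d L / (1 - thetaLoc d L * (((L : ℝ) ^ (j + 1)) ^ 2 * x))) * (((L : ℝ) ^ (j + 1)) ^ 2 * x)
                * (64 * (C1cov d * (L : ℝ) ^ 2 * (d * (2 * (2 * (L : ℝ)) + 1) ^ d)) * ((L : ℝ) ^ d / (L : ℝ) ^ 2)))
            + 2 * (Fintype.card (T4AveragingDeficitWall.Plane d)) * (((L : ℝ) ^ (j + 1)) ^ 2 * x) ^ 2 * m₁ := by
  have hL1 : 1 ≤ L := by omega
  have hL0 : (0 : ℝ) < L := by exact_mod_cast (show 0 < L by omega)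
  have hT : ((tower L N (j + 1) : ℕ) : ℤ) = ((N * L ^ (j + 1) : ℕ) : ℤ) := by rw [tower_eq_pow_mul, Nat.mul_comm]
  have hWPt : IsPeriodicCfg W ((tower L N (j + 1) : ℕ) : ℤ) := by rw [hT]; exact hWP
  set F := periodBox (d := d) (N * L ^ (j + 1)) with hF
  set E : ℝ := energyNormW L (j + 1) W X F with hE
  have hE0 : 0 ≤ E := energyNormW_nonneg _ _ _ _ _
  -- S4a: the tangent residual and the letters of `X_N⁰`
  obtain ⟨hYs, XN0, hXN0, htan, hN0s, hN0P, hν0, hκ0⟩ :=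
    tangentResidual_letters_of_dbar hL hN j hWu hWP hx hsm hWx hθ hθl hε hα hα3 hα4 h52 hb hX hXP hXs hsmall hc₃ hK hS1 h44
      hdbar hΘ₂0 hΘ₂ hΘ₁0 hΘ₁ hΓ₁ hΓ₂ hΓ₃ hΓ₄
  -- the tangent residual `Y' := X − X_N⁰`
  set Y' : Site d → Fin d → Matrix n n ℂ := fun y ν => X y ν - XN0 y ν with hY'
  have hY's : IsSkewDir Y' := fun y ν => (skewAdjoint (Matrix n n ℂ)).sub_mem (hXs y ν) (hN0s y ν)
  have hY'P : IsPeriodicDir Y' ((tower L N (j + 1) : ℕ) : ℤ) := by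
    rw [hT]; intro y i ν; simp only [hY']; rw [hXP y i ν, hN0P y i ν]
  have hY'T : TangentIter L j W Y' := (tangentIter_iff_dirIter_eq_zero L j W Y').mpr htan
  -- leaf-02: the corner-trivial slice-correcting generator
  obtain ⟨mu, hmus, hmuP, hmu0, hmem⟩ := exists_cornerGauge_mem_frameFreeBlockLandauW (M := N) hL1 hLd j hWu hWPt hx hsm hWx hY's hY'P hY'T
  have hmuP' : ∀ (y : Site d) (i : Fin d), mu (y + ((N * L ^ (j + 1) : ℕ) : ℤ) • e i) = mu y := by rw [← hT]; exact hmuP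
  -- the three masses
  have hmem' : (fun y ν => (X y ν - (gaugeDir W (spikeW (L ^ (j + 1)) (framePotW L (j + 1) W X)) + rightInvW hL j hWu hx hsm hWx N hθ hYs) y ν)
      + gaugeDir W mu y ν) ∈ frameFreeBlockLandauW (d := d) (n := n) L N (j + 1) W := by
    rw [← hXN0]; exact hmem
  obtain ⟨hD, hS2, hS1'⟩ := hμ hYs mu hmus hmuP' hmu0 hmem'
  -- the pieces
  set G : Site d → Fin d → Matrix n n ℂ := gaugeDir W mu with hG
  have hGs : IsSkewDir G := gaugeDir_skew hWu hmus
  set P : ℝ := (Fintype.card (T4AveragingDeficitWall.Plane d) : ℝ) with hPdef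
  set M : ℝ := (L : ℝ) ^ (j + 1) with hMdef
  -- the letters of the pure gauge piece
  have hνμ : energyNormW L (j + 1) W G F ≤ Real.sqrt (4 * (M ^ 2 * x) ^ 2 * P * p₂ + m₂) * E :=
    energyNormW_gaugeDir_le_of_masses hL1 j hWu hWx mu F hm₂ hp₂ hE0 hD hS2
  have hκμ : x * ∑ p ∈ perWin d (N * L ^ (j + 1)), ‖curl W G p‖ ≤ 2 * P * (M ^ 2 * x) ^ 2 * m₁ * E ^ 2 :=
    curlL1_gaugeDir_le_of_mass hL1 j (N * L ^ (j + 1)) hWu hx hWx mu hm₁ hS1'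
  -- positivity of the S4a constants
  set νS : ℝ := 2 * Real.sqrt ((P + d) * (3 * Θ₂ + (12288 * ((d : ℝ) ^ 3 * (L : ℝ) ^ 5) * Γ₁ + 3072 * ((d : ℝ) * L) * (C1cov d * (L : ℝ) ^ 2 * Real.sqrt (d * (2 * (2 * L) + 1) ^ d)) ^ 2 * Γ₂)
      * (M * b) ^ 2)) with hνS
  set νR : ℝ := Real.sqrt ((l2C d L / (1 - thetaLoc d L * (M ^ 2 * x)) ^ 2 + curl2C d L / (1 - thetaLoc d L * (M ^ 2 * x)) ^ 2)
      * (1024 * (C1cov d * (L : ℝ) ^ 2 * Real.sqrt (d * (2 * (2 * L) + 1) ^ d)) ^ 2 * ((L : ℝ) ^ d / (L : ℝ) ^ 4))) * (M * b) with hνR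
  set νμ : ℝ := Real.sqrt (4 * (M ^ 2 * x) ^ 2 * P * p₂ + m₂) with hνμdef
  have hνS0 : 0 ≤ νS := by rw [hνS]; positivity
  have hνR0 : 0 ≤ νR := by rw [hνR]; positivity
  have hνμ0 : 0 ≤ νμ := Real.sqrt_nonneg _
  set κS : ℝ := 2 * P * (Θ₁ + (16 * ((d : ℝ) * L) * (6 * Γ₁ + 2 * Γ₄) + 64 * (C1cov d * (L : ℝ) ^ 2 * (d * (2 * (2 * (L : ℝ)) + 1) ^ d)) * Γ₃)) * (M ^ 2 * x) ^ 2 with hκS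
  set κR : ℝ := (curl1C d L / (1 - thetaLoc d L * (M ^ 2 * x))) * (M ^ 2 * x) * (64 * (C1cov d * (L : ℝ) ^ 2 * (d * (2 * (2 * (L : ℝ)) + 1) ^ d)) * ((L : ℝ) ^ d / (L : ℝ) ^ 2))
    with hκR
  set κμ : ℝ := 2 * P * (M ^ 2 * x) ^ 2 * m₁ with hκμdef
  refine ⟨fun y ν => Y' y ν + G y ν, XN0 - G, νS + νR + νμ, κS + κR + κμ, ?_, hmem, ?_, by positivity, ?_, ?_, rfl, rfl⟩
  · -- `X = X_T + X_N`
    funext y ν; simp only [hY', Pi.add_apply, Pi.sub_apply]; abel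
  · -- skewness of `X_N`
    intro y ν; simpa only [Pi.sub_apply] using (skewAdjoint (Matrix n n ℂ)).sub_mem (hN0s y ν) (hGs y ν)
  · -- the ν-letter
    have hsub := energyNormW_sub_le L (j + 1) W XN0 G F
    calc energyNormW L (j + 1) W (XN0 - G) F ≤ energyNormW L (j + 1) W XN0 F + energyNormW L (j + 1) W G F := hsub
      _ ≤ (νS + νR) * E + νμ * E := add_le_add hν0 hνμ
      _ = (νS + νR + νμ) * E := by ring
  · -- the κ-letter
    have hsum : ∑ p ∈ perWin d (N * L ^ (j + 1)), ‖curl W (XN0 - G) p‖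
        ≤ ∑ p ∈ perWin d (N * L ^ (j + 1)), ‖curl W XN0 p‖ + ∑ p ∈ perWin d (N * L ^ (j + 1)), ‖curl W G p‖ := by
      rw [← Finset.sum_add_distrib]
      refine Finset.sum_le_sum fun p _ => ?_
      rw [curl_sub_dir]; exact norm_sub_le _ _
    calc x * ∑ p ∈ perWin d (N * L ^ (j + 1)), ‖curl W (XN0 - G) p‖
        ≤ x * (∑ p ∈ perWin d (N * L ^ (j + 1)), ‖curl W XN0 p‖ + ∑ p ∈ perWin d (N * L ^ (j + 1)), ‖curl W G p‖) :=
          mul_le_mul_of_nonneg_left hsum hx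
      _ = x * ∑ p ∈ perWin d (N * L ^ (j + 1)), ‖curl W XN0 p‖ + x * ∑ p ∈ perWin d (N * L ^ (j + 1)), ‖curl W G p‖ := mul_add _ _ _
      _ ≤ (κS + κR) * E ^ 2 + κμ * E ^ 2 := add_le_add hκ0 hκμ
      _ = (κS + κR + κμ) * E ^ 2 := by ring

end

end Summit.QuantumFields.BalabanUV.T4Continuum.NE7DecompOfDbar
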